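import Summits.ValiantsHypothesis.ValiantsHypothesis.Theorems.KPlusLogSqLawStaticPathGapCharging
import Summits.ValiantsHypothesis.ValiantsHypothesis.Theorems.KPlusLogSqLawStaticPathSilentFlipsCases

/-!
# Route «KPlusLogSqLaw» — parametric max-weight independent set on a path: THE SILENT-FLIP LAW `E ≤ n + M` (sharp form, abstract two-chain process)

HONEST FRAMING.  Helper toward the crux `WeakLifting` (item `stmt-ValiantsHypothesis-19561`, route `KPlusLogSqLaw`, cell `pub-symmetroid`,
seat val-sym-lift-p4 g24, 2026-08-29) on the line of its witness-plan stub `stub_tridiagonalSectorB` (tropical twin of the STATIC tridiagonal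
sector = parametric maximum-weight independent set on a path; located theory `HOME/val-sym-lift-p4/SILENT-FLIP-LAW.md`, THEOREM A).
Sequel of `…StaticPathGapCharging` (the one-for-two form and its charging scheme) and `…StaticPathSilentFlipsCases` (the exit of a partner is
charged once).  For a TWO-CHAIN PROCESS — states `(S k, Lr k, Rr k)`, `k ≤ T`, with the greedy record semantics of offset `e` on the labels
`≤ n` and pairwise distinct heights, consecutive states differing by the adjacent transposition of `x k < y k ≤ n` which reverses that pair,
each pair acted on at most once — THEOREM A of the memo holds in its sharp form (`card_events_le_add_card_changes`):

  `#{k < T : x k ∈ Lr k, y k ∈ Rr k, no record strictly between} ≤ n + #{(k, z) : k < T, z ≤ n, z ∈ N k ↮ z ∈ N (k+1)}`,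

`N k = Lr k ∪ Rr k` the record set: the number of EVENTS is at most `n` plus the number of SILENT FLIPS (label-steps at which the record set
changes).  Proof = the charging of `…GapCharging` (last event of each left end paid by the label; every other event charged to the first
later change of its closed gap) with fibres of size ONE: two events charged to the same change have different left ends `u < u'`, `u'`
cannot lie in the open gap of the first (frozen windows, as in the one-for-two form), so `u'` is the first event's partner and the change is
that partner's exit — excluded by `false_of_two_claims`.  This is the abstract form valid for every allowable sequence (pseudolines
included); the instantiation to the alternating folds of the prefix-sum arrangement is the sequel.  Pure finite combinatorics; nothing here
asserts anything about `WeakLifting`, `TropicalB`, `KPlusLogSqLaw`, the stub in its window, `MatrixDescartes` (stmt-ValiantsHypothesis-18050)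
or `VP ≠ VNP`; the ORDER QUESTION (are the events `O(n)`?) stays open — the silent flips are not bounded here.
-/

set_option linter.dupNamespace false
set_option autoImplicit false

namespace Summit.ValiantsHypothesis.ValiantsHypothesis.Theorems.KPlusLogSqLaw

open Finset Classical

namespace StaticPathFold

section SilentFlips

variable {β : Type*} [LinearOrder β]

/-- **THEOREM A — THE SILENT-FLIP LAW `E ≤ n + M`** for an abstract two-chain process (`HOME/val-sym-lift-p4/SILENT-FLIP-LAW.md` §2–§3).
[folklore] -/
theorem card_events_le_add_card_changes (S : ℕ → ℕ → β) (e n T : ℕ) (x y : ℕ → ℕ) {Lr Rr : ℕ → ℕ → Prop}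
    (hxy : ∀ k, k < T → x k < y k ∧ y k ≤ n)
    (hL0 : ∀ k, k ≤ T → Lr k 0) (hRn : ∀ k, k ≤ T → Rr k n)
    (hSem : ∀ k, k ≤ T → ∀ p u, p < u → u ≤ n → Lr k p → (∀ q, p < q → q < u → ¬ Lr k q) →
      (Lr k u ↔ ((Even (u + e) → S k u < S k p) ∧ (¬ Even (u + e) → S k p < S k u))))
    (hSemR : ∀ k, k ≤ T → ∀ u r, u < r → r ≤ n → Rr k r → (∀ q, u < q → q < r → ¬ Rr k q) →
      (Rr k u ↔ ((Even (u + e) → S k u < S k r) ∧ (¬ Even (u + e) → S k r < S k u))))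
    (hord : ∀ k, k < T → ∀ p q, p ≤ n → q ≤ n → ¬(p = x k ∧ q = y k) → ¬(p = y k ∧ q = x k) →
      (S k p < S k q ↔ S (k + 1) p < S (k + 1) q))
    (hdis : ∀ k, k ≤ T → ∀ p q, p ≤ n → q ≤ n → p ≠ q → S k p ≠ S k q)
    (hadj : ∀ k, k < T → ∀ q, q ≤ n → q ≠ x k → q ≠ y k → (S k q < S k (x k) ↔ S k q < S k (y k)))
    (hflip : ∀ k, k < T → (S k (x k) < S k (y k) ↔ ¬ S (k + 1) (x k) < S (k + 1) (y k)))
    (honce : ∀ k, k < T → ∀ k', k' < T → x k = x k' → y k = y k' → k = k') :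
    ((range T).filter (fun k => Lr k (x k) ∧ Rr k (y k) ∧ ∀ q, x k < q → q < y k → ¬ Lr k q ∧ ¬ Rr k q)).card ≤
      n + (((range T) ×ˢ (range (n + 1))).filter
        (fun kz : ℕ × ℕ => ¬ ((Lr kz.1 kz.2 ∨ Rr kz.1 kz.2) ↔ (Lr (kz.1 + 1) kz.2 ∨ Rr (kz.1 + 1) kz.2)))).card := by
  -- the record process and the event steps
  set N : ℕ → Finset ℕ := fun k => (range (n + 1)).filter (fun u => Lr k u ∨ Rr k u) with hN
  set Ev := (range T).filter (fun k => Lr k (x k) ∧ Rr k (y k) ∧ ∀ q, x k < q → q < y k → ¬ Lr k q ∧ ¬ Rr k q) with hEv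
  set M := ((range T) ×ˢ (range (n + 1))).filter
      (fun kz : ℕ × ℕ => ¬ ((Lr kz.1 kz.2 ∨ Rr kz.1 kz.2) ↔ (Lr (kz.1 + 1) kz.2 ∨ Rr (kz.1 + 1) kz.2))) with hM
  have hmemN : ∀ k u, u ∈ N k ↔ (u ≤ n ∧ (Lr k u ∨ Rr k u)) := by
    intro k u
    rw [hN, mem_filter, mem_range, Nat.lt_succ_iff]
  have hmemEv : ∀ k, k ∈ Ev ↔ (k < T ∧ Lr k (x k) ∧ Rr k (y k) ∧ ∀ q, x k < q → q < y k → ¬ Lr k q ∧ ¬ Rr k q) := by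
    intro k
    rw [hEv, mem_filter, mem_range]
  -- step lemmas along the process
  have hLfl : ∀ k, k < T → ∀ w, w ≤ n → ¬ (Lr (k + 1) w ↔ Lr k w) → w = y k :=
    fun k hk w hw hch => (left_flip_cases (S k) (S (k + 1)) e n (x k) (y k) (hxy k hk).1 (hxy k hk).2 (hL0 k hk.le)
      (hL0 (k + 1) (by omega)) (hSem k hk.le) (hSem (k + 1) (by omega)) (hSemR k hk.le) (hord k hk) (hdis k hk.le) (hadj k hk)
      hw hch).1
  have hRfl : ∀ k, k < T → ∀ w, w ≤ n → ¬ (Rr (k + 1) w ↔ Rr k w) → w = x k :=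
    fun k hk w hw hch => (right_flip_cases (S k) (S (k + 1)) e n (x k) (y k) (hxy k hk).1 (hxy k hk).2 (hRn k hk.le)
      (hRn (k + 1) (by omega)) (hSem k hk.le) (hSemR k hk.le) (hSemR (k + 1) (by omega)) (hord k hk) (hdis k hk.le) (hadj k hk)
      hw hch).1
  have hEvf : ∀ k, k < T → (Lr k (x k) ∧ Rr k (y k) ∧ ∀ q, x k < q → q < y k → ¬ Lr k q ∧ ¬ Rr k q) →
      Lr (k + 1) (x k) ∧ Rr (k + 1) (y k) :=
    fun k hk hev => (event_flips (S k) (S (k + 1)) e n (x k) (y k) (hxy k hk).1 (hxy k hk).2 (hL0 k hk.le) (hL0 (k + 1) (by omega))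
      (hRn k hk.le) (hRn (k + 1) (by omega)) (hSem k hk.le) (hSem (k + 1) (by omega)) (hSemR k hk.le) (hSemR (k + 1) (by omega))
      (hord k hk) (hdis k hk.le) (hdis (k + 1) (by omega)) (hadj k hk) (hflip k hk) hev.1 (fun q h1 h2 => (hev.2.2 q h1 h2).1) hev.2.1
      (fun q h1 h2 => (hev.2.2 q h1 h2).2)).2.2
  -- the three hypotheses of the gap-charging scheme
  have h1 : ∀ k ∈ Ev, k < T ∧ x k < y k ∧ y k ≤ n ∧ x k ∈ N k ∧ y k ∈ N k ∧ ∀ z, x k < z → z < y k → z ∉ N k := by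
    intro k hk
    obtain ⟨hkT, hL, hR, hno⟩ := (hmemEv k).mp hk
    obtain ⟨hxy1, hyn⟩ := hxy k hkT
    refine ⟨hkT, hxy1, hyn, (hmemN k (x k)).mpr ⟨by omega, Or.inl hL⟩, (hmemN k (y k)).mpr ⟨hyn, Or.inr hR⟩,
      fun z hz1 hz2 hz => ?_⟩
    obtain ⟨-, h | h⟩ := (hmemN k z).mp hz
    · exact (hno z hz1 hz2).1 h
    · exact (hno z hz1 hz2).2 h
  have h2 : ∀ k ∈ Ev, N (k + 1) = N k := by
    intro k hk
    obtain ⟨hkT, hL, hR, hno⟩ := (hmemEv k).mp hk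
    obtain ⟨hxy1, hyn⟩ := hxy k hkT
    obtain ⟨hL', hR'⟩ := hEvf k hkT ⟨hL, hR, hno⟩
    ext u
    rw [hmemN, hmemN]
    refine and_congr_right (fun hu => ?_)
    by_cases huy : u = y k
    · subst huy; exact iff_of_true (Or.inr hR') (Or.inr hR)
    · by_cases hux : u = x k
      · subst hux; exact iff_of_true (Or.inl hL') (Or.inl hL)
      · have eL : Lr (k + 1) u ↔ Lr k u := by
          by_contra h; exact huy (hLfl k hkT u hu h)
        have eR : Rr (k + 1) u ↔ Rr k u := by
          by_contra h; exact hux (hRfl k hkT u hu h)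
        rw [eL, eR]
  have h3 : ∀ k ∈ Ev, ∀ k' ∈ Ev, x k = x k' → y k = y k' → k = k' :=
    fun k hk k' hk' hx hy => honce k ((hmemEv k).mp hk).1 k' ((hmemEv k').mp hk').1 hx hy
  -- non-last and last events of each left end
  set P := Ev.filter (fun t => ∃ t' ∈ Ev, t < t' ∧ x t' = x t) with hP
  set Lst := Ev.filter (fun t => ¬ ∃ t' ∈ Ev, t < t' ∧ x t' = x t) with hLst
  have hsplit : P.card + Lst.card = Ev.card := Finset.card_filter_add_card_filter_not _
  have hLst_le : Lst.card ≤ n := by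
    have h : Lst.card ≤ (range n).card := by
      refine Finset.card_le_card_of_injOn x (fun t ht => ?_) (fun t ht t' ht' hx => ?_)
      · obtain ⟨htE, -⟩ := mem_filter.mp ht
        obtain ⟨-, hxy1, hyn, -⟩ := h1 t htE
        exact mem_coe.mpr (mem_range.mpr (by omega))
      · obtain ⟨htE, hno⟩ := mem_filter.mp (mem_coe.mp ht)
        obtain ⟨ht'E, hno'⟩ := mem_filter.mp (mem_coe.mp ht')
        by_contra hne
        rcases lt_or_gt_of_ne hne with hlt | hlt
        · exact hno ⟨t', ht'E, hlt, hx.symm⟩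
        · exact hno' ⟨t, htE, hlt, hx⟩
    simpa using h
  -- the charge
  have hex : ∀ t ∈ P, ∃ s, t < s ∧ (∃ z, x t ≤ z ∧ z ≤ y t ∧ ¬ (z ∈ N s ↔ z ∈ N (s + 1))) ∧
      ∀ r, t < r → r < s → ¬ ∃ z, x t ≤ z ∧ z ≤ y t ∧ ¬ (z ∈ N r ↔ z ∈ N (r + 1)) := by
    intro t ht
    obtain ⟨htE, t', ht'E, htt', hxx⟩ := mem_filter.mp ht
    obtain ⟨s, hs1, -, hz⟩ := exists_change_between h1 h2 h3 htE ht'E htt' hxx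
    exact exists_min_after ⟨s, hs1, hz⟩
  choose! σ hσ1 hσz hσmin using hex
  choose! ζ hζ1 hζ2 hζ3 using hσz
  have hmin : ∀ t ∈ P, ∀ r, t < r → r < σ t → ∀ w, x t ≤ w → w ≤ y t → (w ∈ N r ↔ w ∈ N (r + 1)) := by
    intro t ht r hr1 hr2 w hw1 hw2
    by_contra h
    exact hσmin t ht r hr1 hr2 ⟨w, hw1, hw2, h⟩
  have hfrozen : ∀ t ∈ P, ∀ τ, t ≤ τ → τ ≤ σ t → ∀ w, x t ≤ w → w ≤ y t → (w ∈ N τ ↔ w ∈ N t) :=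
    fun t ht => frozen_of_min (h2 t (mem_filter.mp ht).1) (hmin t ht)
  have hnext : ∀ t ∈ P, ∀ t' ∈ Ev, t < t' → x t' = x t → σ t < t' := by
    intro t ht t' ht'E htt' hxx
    obtain ⟨s, hs1, hs2, z, hz1, hz2, hz3⟩ := exists_change_between h1 h2 h3 (mem_filter.mp ht).1 ht'E htt' hxx
    by_contra h
    exact hz3 (hmin t ht s hs1 (by omega) z hz1 hz2)
  have hσT : ∀ t ∈ P, σ t < T := by
    intro t ht
    obtain ⟨-, t', ht'E, htt', hxx⟩ := mem_filter.mp ht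
    have := hnext t ht t' ht'E htt' hxx
    have := (h1 t' ht'E).1
    omega
  have hmaps : ∀ t ∈ P, (σ t, ζ t) ∈ M := by
    intro t ht
    obtain ⟨htE, -⟩ := mem_filter.mp ht
    have hyn := (h1 t htE).2.2.1
    have hzn : ζ t ≤ n := (hζ2 t ht).trans hyn
    have hch := hζ3 t ht
    rw [hmemN, hmemN] at hch
    rw [hM, mem_filter, mem_product, mem_range, mem_range]
    refine ⟨⟨hσT t ht, by omega⟩, fun hiff => hch ?_⟩
    simp only [hzn, true_and]
    exact hiff
  -- (i) same left end ⇒ same event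
  have hsame : ∀ t ∈ P, ∀ t' ∈ P, x t = x t' → σ t = σ t' → t = t' := by
    intro t ht t' ht' hx hs
    by_contra hne
    rcases lt_or_gt_of_ne hne with hlt | hlt
    · have := hnext t ht t' (mem_filter.mp ht').1 hlt hx.symm
      have := hσ1 t' ht'
      omega
    · have := hnext t' ht' t (mem_filter.mp ht).1 hlt hx
      have := hσ1 t ht
      omega
  -- (ii) the second left end cannot lie in the open gap of the first
  have hgap_false : ∀ t ∈ P, ∀ t' ∈ P, x t < x t' → x t' < y t → σ t = σ t' → False := by
    intro t ht t' ht' hxx hxy' hs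
    obtain ⟨htE, -⟩ := mem_filter.mp ht
    obtain ⟨ht'E, -⟩ := mem_filter.mp ht'
    obtain ⟨-, -, -, -, -, hgap⟩ := h1 t htE
    obtain ⟨-, hxy1', -, hxN', -, -⟩ := h1 t' ht'E
    have hout : ∀ τ, t ≤ τ → τ ≤ σ t → x t' ∉ N τ := fun τ h1' h2' hmem =>
      hgap (x t') hxx hxy' ((hfrozen t ht τ h1' h2' (x t') hxx.le hxy'.le).mp hmem)
    have ha : t' < σ t' := hσ1 t' ht'
    have hb : t < σ t := hσ1 t ht
    have ht't : t' < t := by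
      by_contra h
      exact hout t' (by omega) (by omega) hxN'
    have hc := (hfrozen t' ht' t ht't.le (by omega) (x t') le_rfl hxy1'.le).mpr hxN'
    exact hout t le_rfl hb.le hc
  -- (iii) the second left end cannot be the first event's partner: the exit would be charged twice
  have hpartner_false : ∀ t ∈ P, ∀ t' ∈ P, x t < x t' → x t' = y t → σ t = σ t' → ζ t = y t → False := by
    intro t ht t' ht' hxx hzz hs hζ
    obtain ⟨htE, -⟩ := mem_filter.mp ht
    obtain ⟨ht'E, -⟩ := mem_filter.mp ht'
    obtain ⟨htT, hL, hR, hno⟩ := (hmemEv t).mp htE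
    obtain ⟨ht'T, hL', hR', hno'⟩ := (hmemEv t').mp ht'E
    obtain ⟨-, hxy1, hyn, -, hyN, -⟩ := h1 t htE
    obtain ⟨-, hxy1', hyn', -⟩ := h1 t' ht'E
    have hsT := hσT t ht
    -- frozen windows in record language
    have hfr : ∀ τ, t ≤ τ → τ ≤ σ t → ∀ w, x t ≤ w → w ≤ y t → ((Lr τ w ∨ Rr τ w) ↔ (Lr t w ∨ Rr t w)) := by
      intro τ h1' h2' w hw1 hw2
      have h := hfrozen t ht τ h1' h2' w hw1 hw2
      rw [hmemN, hmemN] at h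
      simpa only [show w ≤ n by omega, true_and] using h
    have hfr' : ∀ τ, t' ≤ τ → τ ≤ σ t → ∀ w, x t' ≤ w → w ≤ y t' → ((Lr τ w ∨ Rr τ w) ↔ (Lr t' w ∨ Rr t' w)) := by
      intro τ h1' h2' w hw1 hw2
      have h := hfrozen t' ht' τ h1' (by omega) w hw1 hw2
      rw [hmemN, hmemN] at h
      simpa only [show w ≤ n by omega, true_and] using h
    have hnx : ∀ k, t < k → k ≤ σ t → (Lr k (x k) ∧ Rr k (y k) ∧ ∀ q, x k < q → q < y k → ¬ Lr k q ∧ ¬ Rr k q) →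
        x k ≠ x t := by
      intro k hk1 hk2 hev hxk
      have hkE : k ∈ Ev := (hmemEv k).mpr ⟨by omega, hev⟩
      have := hnext t ht k hkE hk1 hxk
      omega
    have hnx' : ∀ k, t' < k → k ≤ σ t → (Lr k (x k) ∧ Rr k (y k) ∧ ∀ q, x k < q → q < y k → ¬ Lr k q ∧ ¬ Rr k q) →
        x k ≠ x t' := by
      intro k hk1 hk2 hev hxk
      have hkE : k ∈ Ev := (hmemEv k).mpr ⟨by omega, hev⟩
      have := hnext t' ht' k hkE hk1 hxk
      omega
    -- the exit of `z = y t` at `σ t`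
    have hexit : ¬ Lr (σ t + 1) (y t) ∧ ¬ Rr (σ t + 1) (y t) := by
      have hch := hζ3 t ht
      rw [hζ] at hch
      have hin : y t ∈ N (σ t) := (hfrozen t ht (σ t) (hσ1 t ht).le le_rfl (y t) hxy1.le le_rfl).mpr hyN
      have hout : y t ∉ N (σ t + 1) := fun h => hch (iff_of_true hin h)
      rw [hmemN] at hout
      exact ⟨fun h => hout ⟨hyn, Or.inl h⟩, fun h => hout ⟨hyn, Or.inr h⟩⟩
    exact false_of_two_claims S e n T x y hxy hL0 hRn hSem hSemR hord hdis hadj hflip honce (hσ1 t ht)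
      (by have := hσ1 t' ht'; omega) hsT (by intro h; subst h; exact lt_irrefl _ hxx) hzz ⟨hL, hR, hno⟩ ⟨hL', hR', hno'⟩ hfr hfr'
      hnx hnx' hexit
  -- fibres of the charge are singletons
  have hinj : Set.InjOn (fun t => (σ t, ζ t)) (P : Set ℕ) := by
    intro t ht t' ht' heq
    have ht : t ∈ P := mem_coe.mp ht
    have ht' : t' ∈ P := mem_coe.mp ht'
    simp only [Prod.mk.injEq] at heq
    obtain ⟨hs, hz⟩ := heq
    have hz1 := hζ1 t ht
    have hz2 := hζ2 t ht
    have hz1' := hζ1 t' ht'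
    have hz2' := hζ2 t' ht'
    rcases Nat.lt_trichotomy (x t) (x t') with hlt | heq' | hgt
    · exfalso
      by_cases hin : x t' < y t
      · exact hgap_false t ht t' ht' hlt hin hs
      · have hzz : x t' = y t := by omega
        exact hpartner_false t ht t' ht' hlt hzz hs (by omega)
    · exact hsame t ht t' ht' heq' hs
    · exfalso
      by_cases hin : x t < y t'
      · exact hgap_false t' ht' t ht hgt hin hs.symm
      · have hzz : x t = y t' := by omega
        exact hpartner_false t' ht' t ht hgt hzz hs.symm (by omega)
  have hP_le : P.card ≤ M.card := Finset.card_le_card_of_injOn (fun t => (σ t, ζ t)) (fun t ht => hmaps t (mem_coe.mp ht)) hinj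
  omega

end SilentFlips

end StaticPathFold

end Summit.ValiantsHypothesis.ValiantsHypothesis.Theorems.KPlusLogSqLaw
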